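import Literature.Barriers.Schanuel.NesterenkoModularScopeMeasureClaim
import Literature.Barriers.Schanuel.NesterenkoModularScopeMeasurePolys
import HarnessLib

/-!
# Barrier (Schanuel) `NesterenkoModularScope`: proof of LNM 1752 Ch. 3 Theorem 5.1, the inductive step (pp. 43–46) — proofs only

`Literature/Barriers/Schanuel/NesterenkoModularScopeMeasureStep.lean` — proofs only (no new
definitions). The heart of the induction proving Theorem 5.1 (LNM 1752 Ch. 3 §5, pp. 43–46): given
a homogeneous prime `𝔭` of rank `r` with `t(𝔭) ≤ T` and (22) `log |𝔭(ω̄)| < −2λ¹² T^{4/(4−r)} (log T)^{8r/(4−r)}`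
for `T` large, one

* defines `L` by (23) `2γ₂L⁴ = min{2λ¹² T^{4/(4−r)} (log T)^{8r/(4−r)}, log (1/ρ)}` (`ρ` the distance
  from `ω̄` to `V(𝔭)`; Proposition 4.13 makes `L → ∞` with `T`), `N = [L]`, `B = A_N` from Lemma 2.2
  and `E = x₀ⁿ B(x/x₀)`, `n = [γ₀ L log L]` (`NesterenkoModularScopeMeasurePolys.lean`);
* shows `E ∉ 𝔭` by Corollary 4.9 and the lower bound of Lemma 2.2 (p. 44);
* applies Corollary 4.12 with `η = 1 + [4γ₂/γ₁]`, obtaining for `r ≥ 2` an unmixed `J` of rank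
  `r − 1` with (24)–(26), hence (29) `log |J(ω̄)| ≤ −λ¹² T^{4/(4−r)} (log T)^{8r/(4−r)}` and
  `t(J) ≤ λ⁵ T^{(5−r)/(4−r)} (log T)^{8/(4−r)}`, which contradicts Theorem 5.1 in dimension `r − 2`
  (the induction hypothesis, constant `μ_{r−1} < λ`); for `r = 1` the last clause of Corollary 4.12
  is contradictory by itself ("In the case `r = 1`, inequality (29) does not hold").

`mainStep` is this contradiction, with all "sufficiently large" conditions on `λ` and `T` made
explicit (`exists_Lstar` supplies the threshold in `L`); the growth bookkeeping is in
`NesterenkoModularScopeMeasureGrowth.lean`, the unboundedness of the set of admissible `T` in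
`NesterenkoModularScopeMeasureClaim.lean`, and the assembly of the induction in
`NesterenkoModularScopeMeasureInduction.lean`.

## References

* [NesterenkoPhilippon2001] LNM 1752 (2001), Ch. 3 §5, proof of Theorem 5.1, pp. 43–46
  (PDF pp. 55–58), (22)–(29).
-/

noncomputable section

open Real MvPolynomial
open Literature.NumberTheory.Transcendental Literature.NumberTheory.Transcendental.Nesterenko

attribute [local instance] MvPolynomial.gradedAlgebra

namespace Literature.Barriers.Schanuel

/-! ### The threshold in `L` -/

/-- **"Let now `T` be sufficiently large"**: the four elementary largeness conditions on `L` used on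
pp. 44–45 hold for all `L` beyond an explicit threshold (`log L ≤ L`, Bernoulli's inequality).
[folklore] -/
theorem exists_Lstar {γ₀ γ₁ γ₂ cω : ℝ} (hγ₀ : 0 < γ₀) (hγ₁ : 0 < γ₁) (hγ₂ : 0 < γ₂) (hcω : 0 ≤ cω)
    {η : ℕ} (hη : 4 * γ₂ < η * γ₁) (N₀ : ℕ) :
    ∃ Ls : ℝ, 3 ≤ Ls ∧ ∀ L : ℝ, Ls ≤ L →
      (N₀ : ℝ) + 1 ≤ L ∧
      γ₀ * L * log L ^ 2 + (9 + cω) * γ₀ * L * log L < γ₂ * L ^ 4 ∧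
      8 * γ₀ * L * log L ≤ γ₁ * (L - 1) ^ 4 ∧
      4 * γ₂ * L ^ 4 ≤ η * γ₁ * (L - 1) ^ 4 := by
  have hηγ : 0 < (η : ℝ) * γ₁ := lt_trans (by positivity) hη
  have hη0 : (η : ℝ) ≠ 0 := by
    intro h; rw [h, zero_mul] at hηγ; exact lt_irrefl _ hηγ
  set κ : ℝ := 4 * γ₂ / (η * γ₁) with hκ
  have hκ1 : κ < 1 := by rw [hκ, div_lt_one hηγ]; exact hη
  have hκ0 : 0 < κ := by positivity
  refine ⟨max 3 (max ((N₀ : ℝ) + 1) (max ((10 + cω) * γ₀ / γ₂ + 1)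
    (max (128 * γ₀ / γ₁ + 1) (4 / (1 - κ))))), le_max_left _ _, fun L hL => ?_⟩
  have hL3 : 3 ≤ L := le_trans (le_max_left _ _) hL
  have hL1 : (N₀ : ℝ) + 1 ≤ L := le_trans (le_trans (le_max_left _ _) (le_max_right _ _)) hL
  have hL2 : (10 + cω) * γ₀ / γ₂ + 1 ≤ L :=
    le_trans (le_trans (le_trans (le_max_left _ _) (le_max_right _ _)) (le_max_right _ _)) hL
  have hL4 : 128 * γ₀ / γ₁ + 1 ≤ L :=
    le_trans (le_trans (le_trans (le_trans (le_max_left _ _) (le_max_right _ _))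
      (le_max_right _ _)) (le_max_right _ _)) hL
  have hL5 : 4 / (1 - κ) ≤ L :=
    le_trans (le_trans (le_trans (le_trans (le_max_right _ _) (le_max_right _ _))
      (le_max_right _ _)) (le_max_right _ _)) hL
  have hLpos : 0 < L := by linarith
  have hlogL : log L ≤ L := (log_le_sub_one_of_pos hLpos).trans (by linarith)
  have hlogL0 : 0 ≤ log L := log_nonneg (by linarith)
  have hL1' : 1 ≤ L := by linarith only [hL3]
  have hLlog : L * log L ≤ L ^ 2 := by
    have := mul_le_mul_of_nonneg_left hlogL hLpos.le
    calc L * log L ≤ L * L := this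
      _ = L ^ 2 := by ring
  have hL23 : L ^ 2 ≤ L ^ 3 := by
    have := mul_le_mul_of_nonneg_left hL1' (pow_pos hLpos 2).le
    calc L ^ 2 = L ^ 2 * 1 := by ring
      _ ≤ L ^ 2 * L := this
      _ = L ^ 3 := by ring
  have hL34 : L ^ 3 ≤ L ^ 4 := by
    have := mul_le_mul_of_nonneg_left hL1' (pow_pos hLpos 3).le
    calc L ^ 3 = L ^ 3 * 1 := by ring
      _ ≤ L ^ 3 * L := this
      _ = L ^ 4 := by ring
  refine ⟨hL1, ?_, ?_, ?_⟩
  · -- `γ₀ L log²L + (9 + cω) γ₀ L log L ≤ (10 + cω) γ₀ L³ < γ₂ L⁴`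
    have h1 : log L ^ 2 ≤ L ^ 2 := pow_le_pow_left₀ hlogL0 hlogL 2
    have h2 : γ₀ * L * log L ^ 2 ≤ γ₀ * L ^ 3 := by
      have := mul_le_mul_of_nonneg_left h1 (by positivity : 0 ≤ γ₀ * L)
      calc γ₀ * L * log L ^ 2 = (γ₀ * L) * log L ^ 2 := by ring
        _ ≤ (γ₀ * L) * L ^ 2 := this
        _ = γ₀ * L ^ 3 := by ring
    have h3 : (9 + cω) * γ₀ * L * log L ≤ (9 + cω) * γ₀ * L ^ 3 := by
      have := mul_le_mul_of_nonneg_left (hLlog.trans hL23) (by positivity : 0 ≤ (9 + cω) * γ₀)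
      calc (9 + cω) * γ₀ * L * log L = ((9 + cω) * γ₀) * (L * log L) := by ring
        _ ≤ ((9 + cω) * γ₀) * L ^ 3 := this
        _ = (9 + cω) * γ₀ * L ^ 3 := by ring
    have h4 : (10 + cω) * γ₀ < γ₂ * L := by
      have := (div_le_iff₀ hγ₂).mp (show (10 + cω) * γ₀ / γ₂ ≤ L - 1 by linarith only [hL2])
      nlinarith only [this, hγ₂]
    have h5 : (10 + cω) * γ₀ * L ^ 3 < γ₂ * L * L ^ 3 := mul_lt_mul_of_pos_right h4 (pow_pos hLpos 3)
    calc γ₀ * L * log L ^ 2 + (9 + cω) * γ₀ * L * log L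
        ≤ γ₀ * L ^ 3 + (9 + cω) * γ₀ * L ^ 3 := add_le_add h2 h3
      _ = (10 + cω) * γ₀ * L ^ 3 := by ring
      _ < γ₂ * L * L ^ 3 := h5
      _ = γ₂ * L ^ 4 := by ring
  · -- `8 γ₀ L log L ≤ 8 γ₀ L² ≤ γ₁ L⁴/16 ≤ γ₁ (L−1)⁴`
    have h1 : 8 * γ₀ * L * log L ≤ 8 * γ₀ * L ^ 2 := by
      have := mul_le_mul_of_nonneg_left hLlog (by positivity : 0 ≤ 8 * γ₀)
      calc 8 * γ₀ * L * log L = (8 * γ₀) * (L * log L) := by ring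
        _ ≤ (8 * γ₀) * L ^ 2 := this
        _ = 8 * γ₀ * L ^ 2 := by ring
    have h2 : L / 2 ≤ L - 1 := by linarith only [hL3]
    have h3 : (L / 2) ^ 4 ≤ (L - 1) ^ 4 := pow_le_pow_left₀ (by linarith only [hL3]) h2 4
    have h4 : 128 * γ₀ ≤ γ₁ * L := by
      have := (div_le_iff₀ hγ₁).mp (show 128 * γ₀ / γ₁ ≤ L - 1 by linarith only [hL4])
      nlinarith only [this, hγ₁]
    have h5 : 128 * γ₀ * L ^ 2 ≤ γ₁ * L ^ 4 := by
      have h6 := mul_le_mul_of_nonneg_right h4 (pow_pos hLpos 2).le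
      have h7 := mul_le_mul_of_nonneg_left hL34 hγ₁.le
      calc 128 * γ₀ * L ^ 2 ≤ γ₁ * L * L ^ 2 := h6
        _ = γ₁ * L ^ 3 := by ring
        _ ≤ γ₁ * L ^ 4 := h7
    have h6 := mul_le_mul_of_nonneg_left h3 hγ₁.le
    calc 8 * γ₀ * L * log L ≤ 8 * γ₀ * L ^ 2 := h1
      _ = (128 * γ₀ * L ^ 2) / 16 := by ring
      _ ≤ (γ₁ * L ^ 4) / 16 := by linarith only [h5]
      _ = γ₁ * (L / 2) ^ 4 := by ring
      _ ≤ γ₁ * (L - 1) ^ 4 := h6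
  · -- Bernoulli: `(L−1)⁴ ≥ L⁴ (1 − 4/L)` and `1 − 4/L ≥ κ`
    have h1 : 1 - 4 / L ≥ κ := by
      have h2 : 4 / L ≤ 1 - κ := by
        rw [div_le_iff₀ hLpos]
        have := (div_le_iff₀ (by linarith : 0 < 1 - κ)).mp hL5
        linarith
      linarith
    have h2 : L ^ 4 * (1 - 4 / L) ≤ (L - 1) ^ 4 := by
      have hb : 1 + (4 : ℕ) * (-1 / L) ≤ (1 + -1 / L) ^ 4 :=
        one_add_mul_le_pow (by rw [le_div_iff₀ hLpos]; linarith) 4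
      have e1 : (L - 1) ^ 4 = L ^ 4 * (1 + -1 / L) ^ 4 := by
        field_simp
        ring
      have e2 : (1 : ℝ) - 4 / L = 1 + (4 : ℕ) * (-1 / L) := by push_cast; ring
      rw [e1, e2]
      exact mul_le_mul_of_nonneg_left hb (by positivity)
    have h3 : η * γ₁ * (L ^ 4 * (1 - 4 / L)) ≥ η * γ₁ * (L ^ 4 * κ) :=
      mul_le_mul_of_nonneg_left (mul_le_mul_of_nonneg_left h1 (by positivity)) hηγ.le
    have h4 : η * γ₁ * (L ^ 4 * κ) = 4 * γ₂ * L ^ 4 := by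
      rw [hκ]; field_simp
    calc 4 * γ₂ * L ^ 4 = η * γ₁ * (L ^ 4 * κ) := h4.symm
      _ ≤ η * γ₁ * (L ^ 4 * (1 - 4 / L)) := h3
      _ ≤ η * γ₁ * (L - 1) ^ 4 := mul_le_mul_of_nonneg_left h2 hηγ.le

/-! ### The inductive step -/

/-- **The inductive step of LNM 1752 Ch. 3 Theorem 5.1** (pp. 43–46): from a homogeneous prime `𝔭`
of rank `r ∈ {1, 2, 3}` with `t(𝔭) ≤ T` and `|𝔭(ω̄)| < exp(−2λ¹² T^{4/(4−r)} (log T)^{8r/(4−r)})`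
(`T`, `λ` large as specified), Lemma 2.2's polynomials `A_N` (data `γ₀, γ₁, γ₂, N₀, A`),
Corollaries 4.9, 4.12, Propositions 4.4, 4.13 and — for `r ≥ 2` — Theorem 5.1 in dimension `r − 2`
with constant `μ'`, a contradiction. [cite: NesterenkoPhilippon2001, Ch. 3 §5 (pp. 43–46)] -/
theorem mainStep (h44 : NesterenkoPhilippon2001_ch3_prop_4_4)
    (h49 : NesterenkoPhilippon2001_ch3_cor_4_9) (h412 : NesterenkoPhilippon2001_ch3_cor_4_12)
    (h413 : NesterenkoPhilippon2001_ch3_prop_4_13) {q : ℂ} {r : ℕ} (hr1 : 1 ≤ r) (hr3 : r ≤ 3)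
    {γ₀ γ₁ γ₂ : ℝ} {N₀ : ℕ} {A : ℕ → MvPolynomial (Fin 4) ℤ} (hγ₀ : 0 < γ₀) (hγ₁ : 0 < γ₁)
    (hγ₁₂ : γ₁ < γ₂)
    (hA : ∀ N : ℕ, N₀ ≤ N → ((A N).totalDegree : ℝ) ≤ γ₀ * N * Real.log N ∧
      Real.log (mvPolyHeight (A N) : ℝ) ≤ γ₀ * N * Real.log N ^ 2 ∧
      Real.exp (-(γ₂ * (N : ℝ) ^ 4)) ≤ ‖aeval (ramanujanPoint q) (A N)‖ ∧
      ‖aeval (ramanujanPoint q) (A N)‖ ≤ Real.exp (-(γ₁ * (N : ℝ) ^ 4)))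
    {η : ℕ} (hη : 4 * γ₂ < η * γ₁) {μ' : ℝ} (hμ' : 0 < μ')
    (hprev : 2 ≤ r → ∀ J : Ideal (Rx 4), J.IsHomogeneous (homogeneousSubmodule (Fin 5) ℚ) →
      IsUnmixedOfRank J (r - 1) →
      ∀ T' : ℝ, max (iheight J (r - 1) + ideg J (r - 1)) (exp 1) ≤ T' →
        exp (-(μ' * T' ^ ((4 : ℝ) / (4 - (r - 1 : ℕ))) *
          log T' ^ ((8 : ℝ) * (r - 1 : ℕ) / (4 - (r - 1 : ℕ))))) ≤ iabs J (r - 1) (nesterenkoOmega q))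
    {lam : ℝ} (hlam2 : 2 ≤ lam) (hlamK : 12480 * η * γ₀ * γ₂ ^ (-(1 / 4 : ℝ)) ≤ lam)
    (hlamμ : 12 ^ 8 * (μ' + 1) ≤ lam)
    {Ls : ℝ} (hLs3 : 3 ≤ Ls)
    (hLsP : ∀ L : ℝ, Ls ≤ L → (N₀ : ℝ) + 1 ≤ L ∧
      γ₀ * L * log L ^ 2 + (9 + log ‖nesterenkoOmega q‖) * γ₀ * L * log L < γ₂ * L ^ 4 ∧
      8 * γ₀ * L * log L ≤ γ₁ * (L - 1) ^ 4 ∧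
      4 * γ₂ * L ^ 4 ≤ η * γ₁ * (L - 1) ^ 4)
    {T : ℝ} (hTe : exp 1 ≤ T) (hTlog : 5 * log lam + |log γ₂| ≤ log T)
    (hTL : (6 * γ₂ * Ls ^ 4) ^ 3 ≤ T)
    {𝔭 : Ideal (Rx 4)} (h𝔭 : 𝔭.IsPrime) (h𝔭hom : 𝔭.IsHomogeneous (homogeneousSubmodule (Fin 5) ℚ))
    (h𝔭unm : IsUnmixedOfRank 𝔭 r) (ht𝔭 : iheight 𝔭 r + ideg 𝔭 r ≤ T)
    (h𝔭abs : iabs 𝔭 r (nesterenkoOmega q) <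
      exp (-(2 * lam ^ 12 * (T ^ ((4 : ℝ) / (4 - r)) * log T ^ ((8 : ℝ) * r / (4 - r)))))) :
    False := by
  classical
  /- ### Set-up -/
  set ω := nesterenkoOmega q with hω
  have hω0 : ω ≠ 0 := nesterenkoOmega_ne_zero q
  have hω1 : 1 ≤ ‖ω‖ := one_le_norm_nesterenkoOmega q
  have hlogω : 0 ≤ log ‖ω‖ := log_nonneg hω1
  have h4 := four_sub_pos hr3
  have hr' : (r : ℝ) ≤ 3 := by exact_mod_cast hr3
  have hr1' : (1 : ℝ) ≤ r := by exact_mod_cast hr1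
  have hrpos : (0 : ℝ) < r := by linarith only [hr1']
  obtain ⟨f, hf⟩ : ∃ f : ℝ, T ^ ((4 : ℝ) / (4 - r)) * log T ^ ((8 : ℝ) * r / (4 - r)) = f := ⟨_, rfl⟩
  obtain ⟨g, hg⟩ : ∃ g : ℝ, T ^ (((5 : ℝ) - r) / (4 - r)) * log T ^ ((8 : ℝ) / (4 - r)) = g :=
    ⟨_, rfl⟩
  rw [hf] at h𝔭abs
  have he1 : (1 : ℝ) ≤ exp 1 := by linarith only [add_one_le_exp (1 : ℝ)]
  have hT1 : 1 ≤ T := he1.trans hTe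
  have hT0 : 0 < T := by linarith only [hT1]
  have hlT : 1 ≤ log T := one_le_log_of_exp_one_le hTe
  have hTf : T ≤ f := hf ▸ le_f hr3 hTe
  have hf43 : T ^ ((4 : ℝ) / 3) ≤ f := hf ▸ rpow_four_thirds_le_f hr1 hr3 hTe
  have hTg : T ≤ g := hg ▸ le_g hr3 hTe
  have hgf : g ≤ f := by rw [← hf, ← hg]; exact g_le_f hr1 hr3 hTe
  have hf1 : 1 ≤ f := hT1.trans hTf
  have hf0 : 0 < f := by linarith only [hf1]
  have hg0 : 0 < g := lt_of_lt_of_le hT0 hTg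
  have hlam1 : 1 ≤ lam := by linarith only [hlam2]
  have hlam0 : 0 < lam := by linarith only [hlam2]
  have hlam12 : (4096 : ℝ) ≤ lam ^ 12 := by
    have := pow_le_pow_left₀ (by norm_num : (0 : ℝ) ≤ 2) hlam2 12
    norm_num at this
    exact this
  set X : ℝ := 2 * lam ^ 12 * f with hX
  have hX0 : 0 < X := by positivity
  have hXT : 1538 * T ≤ X := by
    have := mul_le_mul hlam12 hTf hT0.le (by positivity)
    rw [hX]; linarith only [this, hT0]
  have hγ₂ : 0 < γ₂ := by linarith only [hγ₁, hγ₁₂]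
  -- degree and height of `𝔭`
  have hd1 : 1 ≤ ideg 𝔭 r := one_le_ideg_of_isPrime h44 hr1 (by omega) h𝔭 h𝔭hom h𝔭unm
  have hd1' : (1 : ℝ) ≤ ideg 𝔭 r := by exact_mod_cast hd1
  have hd0 : (0 : ℝ) ≤ ideg 𝔭 r := Nat.cast_nonneg _
  have hh0 : 0 ≤ iheight 𝔭 r := height_nonneg _
  have hdT : (ideg 𝔭 r : ℝ) ≤ T := by linarith only [ht𝔭, hh0]
  have hhT : iheight 𝔭 r ≤ T := by linarith only [ht𝔭, hd0]
  set ρ : ℝ := rho ω 𝔭 with hρ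
  have hρ0 : 0 ≤ ρ := rho_nonneg ω 𝔭
  /- ### Step A: Proposition 4.13 bounds `ρ` — "`L` increases up to infinity" -/
  obtain ⟨β, hβ, hβle⟩ := h413 4 r 𝔭 hr1 (by omega) h𝔭hom h𝔭unm ω hω0
  have hρd : ρ ^ ideg 𝔭 r ≤ exp (-(X / (2 * r))) := by
    have h1 : ρ ^ ideg 𝔭 r ≤ projDist ω β ^ ideg 𝔭 r :=
      pow_le_pow_left₀ hρ0 (rho_le_projDist ω hβ) _
    have h2 : iabs 𝔭 r ω * exp (iheight 𝔭 r) ≤ exp (-X + T) := by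
      rw [exp_add]
      exact mul_le_mul h𝔭abs.le (exp_le_exp.mpr hhT) (exp_pos _).le (exp_pos _).le
    have h3 : (iabs 𝔭 r ω * exp (iheight 𝔭 r)) ^ (1 / (r : ℝ)) ≤ exp (-X + T) ^ (1 / (r : ℝ)) :=
      rpow_le_rpow (mul_nonneg (iabs_nonneg _ _ _) (exp_pos _).le) h2 (by positivity)
    have h4 : exp (-X + T) ^ (1 / (r : ℝ)) = exp ((-X + T) / r) := by
      rw [← exp_mul]; congr 1; field_simp
    have h5 : exp (4 * (4 : ℝ) ^ 3 * ideg 𝔭 r) ≤ exp (256 * T) := by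
      rw [exp_le_exp]
      calc 4 * (4 : ℝ) ^ 3 * ideg 𝔭 r = 256 * ideg 𝔭 r := by norm_num
        _ ≤ 256 * T := by linarith only [hdT]
    have h6 : (-X + T) / r + 256 * T ≤ -(X / (2 * r)) := by
      rw [div_add' _ _ _ hrpos.ne', show -(X / (2 * r)) = (-X) / (2 * r) by ring,
        div_le_div_iff₀ hrpos (by positivity)]
      have h7 : r * (1538 * T) ≤ r * X := mul_le_mul_of_nonneg_left hXT hrpos.le
      have h8 : 512 * (r : ℝ) ^ 2 * T ≤ 512 * 3 * r * T := by
        have h9 : (r : ℝ) ^ 2 ≤ 3 * r := by nlinarith only [hr', hrpos]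
        have := mul_le_mul_of_nonneg_left h9 (by positivity : (0 : ℝ) ≤ 512 * T)
        linarith only [this]
      linarith only [h7, h8]
    calc ρ ^ ideg 𝔭 r ≤ projDist ω β ^ ideg 𝔭 r := h1
      _ ≤ (iabs 𝔭 r ω * exp (iheight 𝔭 r)) ^ (1 / (r : ℝ)) * exp (4 * (4 : ℝ) ^ 3 * ideg 𝔭 r) := by
          have := hβle; push_cast at this; exact this
      _ ≤ exp ((-X + T) / r) * exp (256 * T) :=
          mul_le_mul (h3.trans_eq h4) h5 (exp_pos _).le (exp_pos _).le
      _ = exp ((-X + T) / r + 256 * T) := (exp_add _ _).symm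
      _ ≤ exp (-(X / (2 * r))) := exp_le_exp.mpr h6
  have hlogρ : 0 < ρ → log ρ ≤ -(X / (6 * T)) := by
    intro hρpos
    have h1 : (ideg 𝔭 r : ℝ) * log ρ ≤ -(X / (2 * r)) := by
      have := log_le_log (pow_pos hρpos _) hρd
      rwa [log_pow, log_exp] at this
    have h2 : X / (6 * T) ≤ X / (2 * r) / ideg 𝔭 r := by
      rw [div_div, div_le_div_iff₀ (by positivity) (by positivity)]
      have : 2 * (r : ℝ) * ideg 𝔭 r ≤ 6 * T := by nlinarith only [hr', hdT, hrpos, hd0]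
      exact mul_le_mul_of_nonneg_left this hX0.le
    have h3 : log ρ ≤ -(X / (2 * r)) / ideg 𝔭 r := by
      rw [le_div_iff₀ (by positivity)]; linarith only [h1]
    rw [neg_div] at h3
    linarith only [h2, h3]
  -- `M₀ = min{X, log (1/ρ)}` (`= X` if `ρ = 0`), so that `2γ₂L⁴ = M₀` is (23)
  obtain ⟨M₀, hM₀X, hM₀low, hmaxsq, hρM₀⟩ : ∃ M₀ : ℝ, M₀ ≤ X ∧ X / (6 * T) ≤ M₀ ∧
      exp (-(2 * M₀)) ≤ max (exp (-X)) ρ ^ 2 ∧ (0 < ρ → log ρ ≤ -M₀) := by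
    have hX6 : X / (6 * T) ≤ X := div_le_self hX0.le (by linarith only [hT1])
    by_cases hρz : ρ = 0
    · refine ⟨X, le_rfl, hX6, ?_, fun h => absurd hρz h.ne'⟩
      rw [hρz, max_eq_left (exp_pos _).le, pow_two, ← exp_add]
      exact le_of_eq (by ring_nf)
    · have hρpos : 0 < ρ := lt_of_le_of_ne hρ0 (Ne.symm hρz)
      refine ⟨min X (-log ρ), min_le_left _ _, le_min hX6 (by linarith only [hlogρ hρpos]), ?_,
        fun _ => by linarith only [min_le_right X (-log ρ)]⟩
      rcases le_total X (-log ρ) with hle | hle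
      · rw [min_eq_left hle, show -(2 * X) = -X + -X by ring, exp_add, ← pow_two]
        exact pow_le_pow_left₀ (exp_pos _).le (le_max_left _ _) 2
      · rw [min_eq_right hle, show -(2 * -log ρ) = log ρ + log ρ by ring, exp_add,
          exp_log hρpos, ← pow_two]
        exact pow_le_pow_left₀ hρ0 (le_max_right _ _) 2
  have hM₀pos : 0 < M₀ := lt_of_lt_of_le (by positivity) hM₀low
  /- ### Step B: `L`, `N = [L]`, `B = A_N`, `n`, `E` -/
  set L : ℝ := (M₀ / (2 * γ₂)) ^ (1 / 4 : ℝ) with hL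
  have hL0 : 0 ≤ L := rpow_nonneg (by positivity) _
  have hL4 : L ^ 4 = M₀ / (2 * γ₂) := by
    rw [hL, ← rpow_natCast, ← rpow_mul (by positivity)]; norm_num
  have hM₀L : M₀ = 2 * γ₂ * L ^ 4 := by rw [hL4]; field_simp
  have hL4le : L ^ 4 ≤ lam ^ 12 * (T ^ ((4 : ℝ) / (4 - r)) * log T ^ ((8 : ℝ) * r / (4 - r))) / γ₂ := by
    rw [hf, hL4, div_le_div_iff₀ (by positivity) hγ₂]
    have := mul_le_mul_of_nonneg_right hM₀X hγ₂.le
    rw [hX] at this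
    linarith only [this]
  have hLs : Ls ≤ L := by
    have h1 : Ls ^ 4 ≤ L ^ 4 := by
      rw [hL4]
      have h2 : X / (6 * T) / (2 * γ₂) ≤ M₀ / (2 * γ₂) :=
        div_le_div_of_nonneg_right hM₀low (by positivity)
      refine le_trans ?_ h2
      have h3 : 2 * T ^ ((4 : ℝ) / 3) ≤ X := by
        rw [hX]
        have : f ≤ lam ^ 12 * f := le_mul_of_one_le_left hf0.le (one_le_pow₀ hlam1)
        linarith only [this, hf43]
      have h4 : T ^ ((1 : ℝ) / 3) * T = T ^ ((4 : ℝ) / 3) := by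
        conv_lhs => rw [show T ^ ((1 : ℝ) / 3) * T = T ^ ((1 : ℝ) / 3) * T ^ (1 : ℝ) by
          rw [rpow_one]]
        rw [← rpow_add hT0]; norm_num
      have h5 : 6 * γ₂ * Ls ^ 4 ≤ T ^ ((1 : ℝ) / 3) := by
        have h7 : 0 ≤ 6 * γ₂ * Ls ^ 4 := by positivity
        have h8 : ((6 * γ₂ * Ls ^ 4) ^ 3) ^ ((1 : ℝ) / 3) ≤ T ^ ((1 : ℝ) / 3) :=
          rpow_le_rpow (by positivity) hTL (by norm_num)
        rw [← rpow_natCast, ← rpow_mul h7] at h8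
        norm_num at h8
        exact h8
      rw [div_div, le_div_iff₀ (by positivity)]
      calc Ls ^ 4 * (6 * T * (2 * γ₂)) = 2 * ((6 * γ₂ * Ls ^ 4) * T) := by ring
        _ ≤ 2 * (T ^ ((1 : ℝ) / 3) * T) := by
            apply mul_le_mul_of_nonneg_left (mul_le_mul_of_nonneg_right h5 hT0.le) (by norm_num)
        _ = 2 * T ^ ((4 : ℝ) / 3) := by rw [h4]
        _ ≤ X := h3
    exact le_of_pow_le_pow_left₀ (by norm_num) hL0 h1
  obtain ⟨hP1, hP2, hP3, hP4⟩ := hLsP L hLs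
  have hL3 : 3 ≤ L := hLs3.trans hLs
  have hL1 : 1 ≤ L := by linarith only [hL3]
  have hLpos : 0 < L := by linarith only [hL3]
  have hlogL1 : 1 ≤ log L := by
    rw [le_log_iff_exp_le hLpos]
    have := exp_one_lt_d9
    linarith only [this, hL3]
  have hlogL0 : 0 ≤ log L := by linarith only [hlogL1]
  -- `N = [L]`
  set N : ℕ := ⌊L⌋₊ with hN
  have hNL : (N : ℝ) ≤ L := Nat.floor_le hL0
  have hLN : L - 1 ≤ N := by have := Nat.sub_one_lt_floor L; linarith only [this]
  have hN0 : N₀ ≤ N := by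
    rw [hN, Nat.le_floor_iff hL0]; linarith only [hP1]
  have hN3 : 3 ≤ N := by
    rw [hN, Nat.le_floor_iff hL0]; norm_num; exact hL3
  have hN1' : (1 : ℝ) ≤ N := by exact_mod_cast (show 1 ≤ N by omega)
  have hNpos : (0 : ℝ) < N := by linarith only [hN1']
  have hlogN : log N ≤ log L := log_le_log hNpos hNL
  have hlogN0 : 0 ≤ log N := log_nonneg hN1'
  have hN4 : (N : ℝ) ^ 4 ≤ L ^ 4 := pow_le_pow_left₀ hNpos.le hNL 4
  have hLN4 : (L - 1) ^ 4 ≤ (N : ℝ) ^ 4 := pow_le_pow_left₀ (by linarith only [hL1]) hLN 4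
  -- Lemma 2.2 at `N`
  obtain ⟨hdegB, hHB, hlowB, hupB⟩ := hA N hN0
  set B := A N with hB
  rw [ramanujanPoint_eq_nesterenkoOmega_succ, ← hω] at hlowB hupB
  set v : ℝ := ‖aeval (fun i : Fin 4 => ω i.succ) B‖ with hv
  have hv0 : 0 < v := lt_of_lt_of_le (exp_pos _) hlowB
  have hB0 : B ≠ 0 := by
    intro h
    have : v = 0 := by rw [hv, h, map_zero, norm_zero]
    linarith only [this, hv0]
  have hHB1 : 1 ≤ mvPolyHeight B := by
    obtain ⟨m, hm⟩ := MvPolynomial.ne_zero_iff.mp hB0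
    exact Nat.succ_le_of_lt (lt_of_lt_of_le (Int.natAbs_pos.mpr hm)
      (natAbs_coeff_le_mvPolyHeight B m))
  have hHB1' : (1 : ℝ) ≤ mvPolyHeight B := by exact_mod_cast hHB1
  -- `n = [γ₀ L log L]`
  set n : ℕ := ⌊γ₀ * L * log L⌋₊ with hn
  have hγLl : 0 ≤ γ₀ * L * log L := by positivity
  have hnle : (n : ℝ) ≤ γ₀ * L * log L := Nat.floor_le hγLl
  have hn0 : (0 : ℝ) ≤ n := Nat.cast_nonneg n
  have hNLlog : γ₀ * N * log N ≤ γ₀ * L * log L :=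
    mul_le_mul (mul_le_mul_of_nonneg_left hNL hγ₀.le) hlogN hlogN0 (by positivity)
  have hdegBn : B.totalDegree ≤ n := by
    rw [hn, Nat.le_floor_iff hγLl]
    exact hdegB.trans hNLlog
  -- `n ≥ 1` (the hypothesis `deg E ≥ 1` of Corollary 4.12): `B` is not constant, since
  -- `B ∈ ℤ[y]`, `B ≠ 0` and `|B(ω̄)| ≤ e^{−γ₁N⁴} < 1`
  have hn1 : 1 ≤ n := by
    refine le_trans ?_ hdegBn
    by_contra hdeg
    have hdeg0 : B.totalDegree = 0 := by omega
    rw [totalDegree_eq_zero_iff_eq_C] at hdeg0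
    have hc0 : B.coeff 0 ≠ 0 := by
      intro h
      exact hB0 (by rw [hdeg0, h, C_0])
    have hv1 : 1 ≤ v := by
      rw [hv, hdeg0, aeval_C, algebraMap_int_eq, eq_intCast, Complex.norm_intCast, ← Int.cast_abs,
        ← Int.cast_one, Int.cast_le]
      exact Int.one_le_abs hc0
    have hv2 : v < 1 := by
      refine lt_of_le_of_lt hupB ?_
      rw [exp_lt_one_iff, neg_lt_zero]
      positivity
    linarith only [hv1, hv2]
  -- the homogenised polynomial `E`
  obtain ⟨E, hEhom, hEval, hEmax, hEh, hEnz⟩ := exists_homogenization B hdegBn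
  obtain ⟨hE0, hEdeg⟩ := hEnz hB0
  have hEω : aeval ω E = aeval (fun i : Fin 4 => ω i.succ) B := hEval ω (by rw [hω]; rfl)
  have hvE : ‖aeval ω E‖ = v := by rw [hEω]
  have hmaxE1 : 1 ≤ maxNorm E := by rw [hEmax]; exact hHB1'
  have hnormAt_le : normAt ω E ≤ v := hvE ▸ normAt_le_norm_aeval ω E hmaxE1 hω1
  have hnormAt0 : 0 ≤ normAt ω E := normAt_nonneg _ _
  have hlogsq : γ₀ * N * log N ^ 2 ≤ γ₀ * L * log L ^ 2 :=
    mul_le_mul (mul_le_mul_of_nonneg_left hNL hγ₀.le) (pow_le_pow_left₀ hlogN0 hlogN 2)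
      (by positivity) (by positivity)
  have hHB' : log (mvPolyHeight B : ℝ) ≤ γ₀ * L * log L ^ 2 := hHB.trans hlogsq
  have hhE : height E ≤ γ₀ * L * log L ^ 2 := hEh.trans hHB'
  have hhE0 : 0 ≤ height E := height_nonneg _
  /- ### Step C: `E ∉ 𝔭` (Corollary 4.9 against the lower bound of Lemma 2.2) -/
  have hEnot : E ∉ 𝔭 := by
    intro hE𝔭
    have h1 := h49 4 r 𝔭 hr1 (by omega) h𝔭 h𝔭hom h𝔭unm E n hE𝔭 hEhom ω hω0
    have h1' : normAt ω E ≤ ρ * exp (9 * n) := by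
      have : ((2 * (4 : ℕ) + 1 : ℝ) * n) = 9 * n := by norm_num
      rw [this] at h1; exact h1
    have h2 : v = normAt ω E * (maxNorm E * ‖ω‖ ^ n) := by
      rw [← hvE, ← hEdeg]
      exact norm_aeval_eq_normAt_mul ω E (by linarith only [hmaxE1] : 0 < maxNorm E).ne' hω0
    by_cases hρz : ρ = 0
    · rw [hρz, zero_mul] at h1'
      have h3 : normAt ω E = 0 := le_antisymm h1' hnormAt0
      rw [h3, zero_mul] at h2
      linarith only [h2, hv0]
    · have hρpos : 0 < ρ := lt_of_le_of_ne hρ0 (Ne.symm hρz)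
      have h3 : v ≤ ρ * exp (9 * n) * ((mvPolyHeight B : ℝ) * ‖ω‖ ^ n) := by
        rw [h2, hEmax]
        exact mul_le_mul_of_nonneg_right h1' (by positivity)
      have h4 : log v ≤ log ρ + 9 * n + log (mvPolyHeight B : ℝ) + n * log ‖ω‖ := by
        have := log_le_log hv0 h3
        rw [log_mul (by positivity) (by positivity), log_mul hρpos.ne' (exp_pos _).ne', log_exp,
          log_mul (by positivity) (by positivity), log_pow] at this
        linarith only [this]
      have h5 : -(γ₂ * (N : ℝ) ^ 4) ≤ log v := by
        have := log_le_log (exp_pos _) hlowB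
        rwa [log_exp] at this
      have h6 : log ρ ≤ -(2 * γ₂ * L ^ 4) := by rw [← hM₀L]; exact hρM₀ hρpos
      have h7 : 9 * (n : ℝ) + n * log ‖ω‖ ≤ (9 + log ‖ω‖) * γ₀ * L * log L := by
        have := mul_le_mul_of_nonneg_left hnle (show 0 ≤ 9 + log ‖ω‖ by linarith only [hlogω])
        linarith only [this]
      have h8 : γ₂ * (N : ℝ) ^ 4 ≤ γ₂ * L ^ 4 := mul_le_mul_of_nonneg_left hN4 hγ₂.le
      linarith only [hP2, h4, h5, h6, h7, h8, hHB']
  /- ### Step D: Corollary 4.12 -/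
  have hη0' : (0 : ℝ) < η := by
    by_contra h
    push Not at h
    nlinarith only [h, hη, hγ₁, hγ₂]
  have hη0 : 0 < η := by exact_mod_cast hη0'
  -- hypothesis 2: `‖E‖_ω̄ ≤ e^{−8n}`
  have hyp2 : normAt ω E ≤ exp (-(2 * ((4 : ℕ) : ℝ) * n)) := by
    have h1 : 2 * ((4 : ℕ) : ℝ) * n = 8 * n := by norm_num
    rw [h1]
    refine hnormAt_le.trans (hupB.trans ?_)
    rw [exp_le_exp, neg_le_neg_iff]
    have h2 : 8 * (n : ℝ) ≤ 8 * (γ₀ * L * log L) := by linarith only [hnle]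
    have h3 := mul_le_mul_of_nonneg_left hLN4 hγ₁.le
    linarith only [h2, hP3, h3]
  -- hypothesis 3: `‖E‖_ω̄^η ≤ max(e^{−X}, ρ)²`
  have hyp3 : normAt ω E ^ η ≤ max (exp (-X)) ρ ^ 2 := by
    have h1 : normAt ω E ^ η ≤ v ^ η := pow_le_pow_left₀ hnormAt0 hnormAt_le η
    have h2 : v ^ η ≤ exp (-(γ₁ * (N : ℝ) ^ 4)) ^ η := pow_le_pow_left₀ hv0.le hupB η
    have h3 : exp (-(γ₁ * (N : ℝ) ^ 4)) ^ η = exp (-(η * γ₁ * (N : ℝ) ^ 4)) := by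
      rw [← exp_nat_mul]; congr 1; ring
    have h4 : exp (-(η * γ₁ * (N : ℝ) ^ 4)) ≤ exp (-(2 * M₀)) := by
      rw [exp_le_exp, neg_le_neg_iff, hM₀L]
      have : (η : ℝ) * γ₁ * (L - 1) ^ 4 ≤ η * γ₁ * (N : ℝ) ^ 4 :=
        mul_le_mul_of_nonneg_left hLN4 (by positivity)
      linarith only [this, hP4]
    exact h1.trans (h2.trans (h3.le.trans (h4.trans hmaxsq)))
  have h412app := h412 4 r 𝔭 E n hr1 (by omega) h𝔭 h𝔭hom h𝔭unm hE0 hEhom hn1 hEnot ω X η hω0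
    hX0 hη0 h𝔭abs.le hyp2 hyp3
  push_cast at h412app
  obtain ⟨hJcase, h1case⟩ := h412app
  -- the common quantity `Φ = h(𝔭) n + h(E) deg 𝔭 + 192 n deg 𝔭` and its bound `ηΦ ≤ λ⁴ g`
  have hW : T * L * log L ^ 2 ≤ 64 * lam ^ 3 * γ₂ ^ (-(1 / 4 : ℝ)) * g :=
    hg ▸ T_mul_L_mul_log_sq_le hr1 hr3 hγ₂ hlam1 hTe hTlog hL1 hL4le
  have hlg : 0 ≤ lam ^ 4 * g := by positivity
  have hcore : (η : ℝ) * γ₀ * (T * L * log L ^ 2) * 195 ≤ lam ^ 4 * g := by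
    have h1 : (η : ℝ) * γ₀ * (T * L * log L ^ 2) * 195 ≤
        (η : ℝ) * γ₀ * (64 * lam ^ 3 * γ₂ ^ (-(1 / 4 : ℝ)) * g) * 195 := by
      apply mul_le_mul_of_nonneg_right _ (by norm_num)
      exact mul_le_mul_of_nonneg_left hW (by positivity)
    have h2 : (η : ℝ) * γ₀ * (64 * lam ^ 3 * γ₂ ^ (-(1 / 4 : ℝ)) * g) * 195 =
        (12480 * η * γ₀ * γ₂ ^ (-(1 / 4 : ℝ))) * (lam ^ 3 * g) := by ring
    have h3 : (12480 * η * γ₀ * γ₂ ^ (-(1 / 4 : ℝ))) * (lam ^ 3 * g) ≤ lam * (lam ^ 3 * g) :=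
      mul_le_mul_of_nonneg_right hlamK (by positivity)
    calc _ ≤ _ := h1
      _ = _ := h2
      _ ≤ lam * (lam ^ 3 * g) := h3
      _ = lam ^ 4 * g := by ring
  have hTγ : T * (γ₀ * L * log L) ≤ γ₀ * (T * L * log L ^ 2) := by
    have := mul_le_mul_of_nonneg_left hlogL1 (by positivity : 0 ≤ T * (γ₀ * L * log L))
    calc T * (γ₀ * L * log L) = T * (γ₀ * L * log L) * 1 := by ring
      _ ≤ T * (γ₀ * L * log L) * log L := this
      _ = γ₀ * (T * L * log L ^ 2) := by ring
  have hΦ : iheight 𝔭 r * n + height E * ideg 𝔭 r + 192 * n * ideg 𝔭 r ≤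
      194 * (γ₀ * (T * L * log L ^ 2)) := by
    have h1 : iheight 𝔭 r * n ≤ T * (γ₀ * L * log L) := mul_le_mul hhT hnle hn0 hT0.le
    have h3 : height E * ideg 𝔭 r ≤ (γ₀ * L * log L ^ 2) * T :=
      mul_le_mul hhE hdT hd0 (by positivity)
    have h4 : (n : ℝ) * ideg 𝔭 r ≤ (γ₀ * L * log L) * T := mul_le_mul hnle hdT hd0 hγLl
    linarith only [h1, hTγ, h3, h4]
  have hηΦ : (η : ℝ) * (iheight 𝔭 r * n + height E * ideg 𝔭 r + 192 * n * ideg 𝔭 r) ≤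
      lam ^ 4 * g := by
    have h1 : (η : ℝ) * (iheight 𝔭 r * n + height E * ideg 𝔭 r + 192 * n * ideg 𝔭 r) ≤
        η * (194 * (γ₀ * (T * L * log L ^ 2))) := mul_le_mul_of_nonneg_left hΦ hη0'.le
    linarith only [h1, hcore, hlg]
  have hlam4f : lam ^ 4 * f ≤ lam ^ 12 * f :=
    mul_le_mul_of_nonneg_right (pow_le_pow_right₀ hlam1 (by norm_num)) hf0.le
  rcases Nat.lt_or_ge r 2 with hr2 | hr2
  · /- #### `r = 1`: the last clause of Corollary 4.12 is contradictory -/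
    have hr : r = 1 := by omega
    have h1 := h1case hr
    have h2 : 0 ≤ -X + η * (iheight 𝔭 r * n + height E * ideg 𝔭 r + 192 * n * ideg 𝔭 r) := by
      have h0 : exp 0 ≤ exp (-X + η * (iheight 𝔭 r * n + height E * ideg 𝔭 r +
          12 * 4 ^ 2 * n * ideg 𝔭 r)) := by rw [exp_zero]; exact h1
      have := exp_le_exp.mp h0
      linarith only [this]
    have h3 : X ≤ lam ^ 4 * g := by linarith only [h2, hηΦ]
    rw [hX] at h3
    have h4 := mul_le_mul_of_nonneg_left hgf (pow_pos hlam0 4).le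
    have h5 := mul_pos (pow_pos hlam0 12) hf0
    linarith only [h3, h4, hlam4f, h5]
  · /- #### `r ≥ 2`: the ideal `J` and Theorem 5.1 in dimension `r − 2` -/
    obtain ⟨J, hJhom, hJunm, -, hJdeg, hJh, hJabs⟩ := hJcase hr2
    -- `t(J) ≤ λ⁵ g`
    have htJ : iheight J (r - 1) + ideg J (r - 1) ≤ lam ^ 5 * g := by
      have h1 : iheight J (r - 1) ≤ lam ^ 4 * g := by
        refine hJh.trans (le_trans ?_ hηΦ)
        apply mul_le_mul_of_nonneg_left _ hη0'.le
        have hnd : 0 ≤ (n : ℝ) * ideg 𝔭 r := by positivity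
        have : (4 : ℝ) * (r + 2) * n * ideg 𝔭 r ≤ 192 * n * ideg 𝔭 r := by
          nlinarith only [hnd, hr', hrpos]
        linarith only [this]
      have h2 : (ideg J (r - 1) : ℝ) ≤ lam ^ 4 * g := by
        have h3 : (ideg J (r - 1) : ℝ) ≤ η * ideg 𝔭 r * n := by exact_mod_cast hJdeg
        have h4 : (η : ℝ) * ideg 𝔭 r * n ≤ η * (T * (γ₀ * L * log L)) := by
          have h6 : (ideg 𝔭 r : ℝ) * n ≤ T * (γ₀ * L * log L) := mul_le_mul hdT hnle hn0 hT0.le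
          have := mul_le_mul_of_nonneg_left h6 hη0'.le
          linarith only [this]
        have h5 : (η : ℝ) * (T * (γ₀ * L * log L)) ≤ η * γ₀ * (T * L * log L ^ 2) := by
          have := mul_le_mul_of_nonneg_left hTγ hη0'.le
          linarith only [this]
        linarith only [h3, h4, h5, hcore, hlg]
      have h6 : lam ^ 4 * g ≤ lam ^ 4 * g * (lam / 2) :=
        le_mul_of_one_le_right hlg (by linarith only [hlam2])
      linarith only [h1, h2, h6]
    set T' : ℝ := lam ^ 5 * g with hT'
    have hT'ge : max (iheight J (r - 1) + ideg J (r - 1)) (exp 1) ≤ T' := by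
      refine max_le htJ ?_
      have : g ≤ lam ^ 5 * g := le_mul_of_one_le_left hg0.le (one_le_pow₀ hlam1)
      linarith only [this, hTe, hTg, hT']
    have hlow := hprev hr2 J hJhom hJunm T' hT'ge
    have hTlog' : 5 * log lam ≤ log T := by linarith only [hTlog, abs_nonneg (log γ₂)]
    have hfp : T' ^ ((4 : ℝ) / (4 - (r - 1 : ℕ))) *
        log T' ^ ((8 : ℝ) * (r - 1 : ℕ) / (4 - (r - 1 : ℕ))) ≤ 12 ^ 8 * lam ^ 10 * f := by
      have := f_prev_le hr2 hr3 hlam1 hTe hTlog'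
      simp only [hg, hf] at this
      exact this
    -- `exp(−μ' 12⁸ λ¹⁰ f) ≤ |J| ≤ exp(−X + ηΦ) ≤ exp(−2λ¹² f + λ⁴ g)`
    have h1 : exp (-(μ' * (12 ^ 8 * lam ^ 10 * f))) ≤ iabs J (r - 1) ω := by
      refine le_trans ?_ hlow
      rw [exp_le_exp, neg_le_neg_iff]
      have := mul_le_mul_of_nonneg_left hfp hμ'.le
      calc μ' * T' ^ ((4 : ℝ) / (4 - (r - 1 : ℕ))) *
            log T' ^ ((8 : ℝ) * (r - 1 : ℕ) / (4 - (r - 1 : ℕ)))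
          = μ' * (T' ^ ((4 : ℝ) / (4 - (r - 1 : ℕ))) *
            log T' ^ ((8 : ℝ) * (r - 1 : ℕ) / (4 - (r - 1 : ℕ)))) := by ring
        _ ≤ μ' * (12 ^ 8 * lam ^ 10 * f) := this
    have h2 : iabs J (r - 1) ω ≤ exp (-X + lam ^ 4 * g) :=
      hJabs.trans (exp_le_exp.mpr (by linarith only [hηΦ]))
    have h3 : -(μ' * (12 ^ 8 * lam ^ 10 * f)) ≤ -X + lam ^ 4 * g := exp_le_exp.mp (h1.trans h2)
    rw [hX] at h3
    -- arithmetic: `2λ¹² f ≤ μ' 12⁸ λ¹⁰ f + λ⁴ f ≤ (12⁸ μ' + 1) λ¹⁰ f`, `λ ≥ 12⁸(μ' + 1)`, `λ ≥ 2`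
    have h4 : lam ^ 4 * g ≤ lam ^ 10 * f := by
      have : lam ^ 4 ≤ lam ^ 10 := pow_le_pow_right₀ hlam1 (by norm_num)
      exact mul_le_mul this hgf hg0.le (by positivity)
    have h5 : 2 * lam ^ 2 * (lam ^ 10 * f) ≤ (12 ^ 8 * μ' + 1) * (lam ^ 10 * f) := by
      have e1 : 2 * lam ^ 2 * (lam ^ 10 * f) = 2 * lam ^ 12 * f := by ring
      have e2 : (12 ^ 8 * μ' + 1) * (lam ^ 10 * f) = μ' * (12 ^ 8 * lam ^ 10 * f) + lam ^ 10 * f := by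
        ring
      rw [e1, e2]
      linarith only [h3, h4]
    have h6 : 2 * lam ^ 2 ≤ 12 ^ 8 * μ' + 1 := le_of_mul_le_mul_right h5 (by positivity)
    have h7 : lam ≤ lam ^ 2 := by nlinarith only [hlam1]
    linarith only [h6, hlamμ, h7, hμ']

end Literature.Barriers.Schanuel

end
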